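import Summits.NavierStokesRegularity.NavierStokesRegularity.Theses.ExtremiserTransience
import Literature.Analysis.FluidPDE.VorticityCalculus
import HarnessLib

/-!
# Route `ExtremiserTransience` — LINE g5-α «plateau transfer», REPAIR of the critic prices P1/P2 (seat ns-idea-5 g5)

`--supports stmt-NavierStokesRegularity-27824` (the glue item `PlateauTransferOfSlice` of the split of `PlateauTransfer`, 27677,
into `PlateauSliceTransfer` (27822) and `PlateauSliceRigidity` (27823); route rev 19).

Content (pure logic, kernel-checked against the route file):
* `plateauTransferOfSlice : PlateauTransferOfSlice` — ex falso: the weak-class one-slice plateau object produced by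
  `PlateauSliceTransfer` is excluded by `PlateauSliceRigidity`, so `PlateauTransfer`'s conclusion holds vacuously;
* `plateauAncientRigidity_of_slice : PlateauSliceRigidity → PlateauAncientRigidity` — the positive-measure-window rigidity item
  (27678) follows from the one-slice rigidity: pick one plateau time `t` of the window (the set has positive measure, hence is
  non-empty), note `t < 0` and that the plateau level `M` is positive because `curl (W t) ≢ 0` (a field with `‖W t ·‖ ≤ 0` is `0` and
  `curl 0 = 0`), and continuity of `uncurry W` on `(-∞,0) × ℝ³` is part of `IsKNSSBlowupLimit` (smoothness);
* `netpf_of_slice` — hence `LocalNearPlateauStability` (27676) with the two children gives the rung `NearExtremalTransiencePerFlow`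
  (26567) by name (directly: the slice object is excluded).
So after this file the OPEN content of LINE g5-α is exactly {27676, 27822, 27823} (27677 and 27678 follow from them).
WHY THE SPLIT (critic P1, centre selection / tightness): `IsKNSSBlowupLimit`-type classes are intrinsic, so the blow-up zoom may follow the
plateau balls of `LocalNearPlateauStability`; what such a moving-centre zoom reaches is a slice object (one interior time, level = slice
sup, no `sup = 1` normalisation) — the class of `PlateauSliceTransfer`; and one slice already suffices for rigidity because a
positive-volume level set of the real-analytic slice forces constant speed on `ℝ³`, which the local energy budget
`∫_{B_ρ} ‖W t₀‖² ≲ ρ² / √(−t₀)` of Type-I-decaying Oseen-mild ancient fields forbids (docstrings of 27822/27823).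
HONEST FRAMING: implications between OPEN statements about hypothetical Type-I singular flows; nothing about Navier–Stokes
regularity or blow-up is proved here, and no summit is proved by a line. [folklore]
-/

namespace Summit.NavierStokesRegularity.NavierStokesRegularity.Theses.ExtremiserTransience
set_option linter.dupNamespace false

open MeasureTheory

/-- The glue item `PlateauTransferOfSlice` (stmt-NavierStokesRegularity-27824): ex falso. -/
theorem plateauTransferOfSlice : PlateauTransferOfSlice := by
  intro h1 h2 hL C ν T hC hν hT0 u p hcl hLH hdec hrate hnoext hno
  exact (h2 (h1 hL C ν T hC hν hT0 u p hcl hLH hdec hrate hnoext hno)).elim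

/-- `PlateauSliceRigidity` (27823) implies the window rigidity item `PlateauAncientRigidity` (27678). -/
theorem plateauAncientRigidity_of_slice (h2 : PlateauSliceRigidity) : PlateauAncientRigidity := by
  rintro ⟨W, K, a, b, ⟨hKNSS, hmild⟩, hdec, hab, hb, hvol⟩
  obtain ⟨t, ht⟩ := nonempty_of_measure_ne_zero (ne_of_gt hvol)
  obtain ⟨⟨hta, htb⟩, ⟨M, hM, hplat⟩, ⟨x₀, hx₀⟩⟩ := ht
  have ht0 : t < 0 := lt_of_lt_of_le htb hb
  have hMpos : 0 < M := by
    refine lt_of_not_ge fun hle => ?_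
    have hW0 : W t = 0 := by
      funext y
      have h := (hM y).trans hle
      simpa using (norm_le_zero_iff.mp h)
    apply hx₀
    rw [hW0]
    exact Literature.Analysis.FluidPDE.curl_zero x₀
  exact h2 ⟨W, K, t, M, hKNSS.smooth.continuousOn, hmild, hdec, ht0, hMpos, hM, hplat⟩

/-- LINE g5-α after the repair: 27676 + 27822 + 27823 give the rung `NearExtremalTransiencePerFlow` (26567). -/
theorem netpf_of_slice (hL : LocalNearPlateauStability) (h1 : PlateauSliceTransfer)
    (h2 : PlateauSliceRigidity) : NearExtremalTransiencePerFlow := by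
  intro C ν T hC hν hT0 u p hcl hLH hdec hrate hnoext
  by_contra hno
  exact h2 (h1 hL C ν T hC hν hT0 u p hcl hLH hdec hrate hnoext hno)

end Summit.NavierStokesRegularity.NavierStokesRegularity.Theses.ExtremiserTransience
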